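import Literature.AlgebraicGeometry.Resolution.RegularLocalRingsProofs
import Mathlib.RingTheory.KrullDimension.Regular
import HarnessLib

/-!
# Crux `EquisingularLift` (stmt-ResolutionOfSingularities-15660), line `Sketch` (= `strata-split` v6):
# move-set stub `stub_trace_hypersurfaceLike`

[OURS · L1 W4.5b] Registered stub of the skeleton `Cruxes/EquisingularLift/Lines/Sketch.lean`
(sha `ec60f88acc0b`), proved BY NAME AND SIGNATURE. NOT a statement of any manuscript.

**Statement** (trace dictionary, converse). `R` regular local, `𝔮` an ideal with `R/𝔮` regular local,
`ϖ ∈ 𝔪 ∖ 𝔮`. Then the trace `R/(𝔮 + (ϖ))` has dimension `dim R/𝔮 - 1` and embedding dimension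
`≤ dim R/(𝔮 + (ϖ)) + 1` (it is "hypersurface-like").

**Proof.** `A := R/𝔮` is a regular local ring, hence a domain (Matsumura Thm. 14.3,
`isDomain_of_isRegularLocalRing`); the image `x` of `ϖ` is a non-zero element of `𝔪_A`, hence a
non-zero-divisor, so `dim A/(x) + 1 = dim A` (Krull,
`ringKrullDim_quotient_span_singleton_succ_eq_ringKrullDim_of_mem_nonZeroDivisors`). The third
isomorphism theorem identifies `A/(x)` with `R/(𝔮 + (ϖ))`. Finally `𝔪·R/(𝔮 + (ϖ))` is the image of
`𝔪_A`, so it needs at most `μ(𝔪_A) = dim A = dim R/(𝔮 + (ϖ)) + 1` generators.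
-/

set_option linter.dupNamespace false -- mandated namespace `Summit.<Summit>.<Problem>` of this single-conjunct summit

namespace Summit.ResolutionOfSingularities.ResolutionOfSingularities.Cruxes.EquisingularLift.StrataSplit

open IsLocalRing Literature.AlgebraicGeometry.Resolution

/-- **Stub `stub_trace_hypersurfaceLike`** of line `Sketch` for the crux `EquisingularLift`
(stmt-ResolutionOfSingularities-15660), by name and signature: if `R` and `R/𝔮` are regular local and
`ϖ ∈ 𝔪 ∖ 𝔮`, then `dim R/(𝔮 + (ϖ)) + 1 = dim R/𝔮` and `μ(𝔪·R/(𝔮 + (ϖ))) ≤ dim R/(𝔮 + (ϖ)) + 1`.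
[OURS · L1 W4.5b] move-set lemma; NOT a statement of the manuscript. -/
theorem stub_trace_hypersurfaceLike : ∀ (R : Type) [CommRing R] [IsRegularLocalRing R] (𝔮 : Ideal R) (ϖ : R), IsRegularLocalRing (R ⧸ 𝔮) → ϖ ∈ IsLocalRing.maximalIdeal R → ϖ ∉ 𝔮 → ringKrullDim (R ⧸ (𝔮 ⊔ Ideal.span {ϖ})) + 1 = ringKrullDim (R ⧸ 𝔮) ∧ ((Ideal.map (Ideal.Quotient.mk (𝔮 ⊔ Ideal.span {ϖ})) (IsLocalRing.maximalIdeal R)).spanFinrank : WithBot ℕ∞) ≤ ringKrullDim (R ⧸ (𝔮 ⊔ Ideal.span {ϖ})) + 1 := by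
  intro R _ _ 𝔮 ϖ hreg hϖ hϖ𝔮
  haveI := hreg
  haveI : IsDomain (R ⧸ 𝔮) := isDomain_of_isRegularLocalRing (R ⧸ 𝔮)
  -- the image `x` of `ϖ` in `A = R/𝔮`
  set x : R ⧸ 𝔮 := Ideal.Quotient.mk 𝔮 ϖ with hx
  have hx0 : x ≠ 0 := by
    rw [hx, Ne, Ideal.Quotient.eq_zero_iff_mem]
    exact hϖ𝔮
  have hmax : maximalIdeal (R ⧸ 𝔮) = (maximalIdeal R).map (Ideal.Quotient.mk 𝔮) :=
    maximalIdeal_quotient_eq_map 𝔮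
  have hxm : x ∈ maximalIdeal (R ⧸ 𝔮) := by
    rw [hmax]
    exact Ideal.mem_map_of_mem _ hϖ
  -- Krull: `dim A/(x) + 1 = dim A`
  have hdimA : ringKrullDim ((R ⧸ 𝔮) ⧸ Ideal.span {x}) + 1 = ringKrullDim (R ⧸ 𝔮) :=
    ringKrullDim_quotient_span_singleton_succ_eq_ringKrullDim_of_mem_nonZeroDivisors
      (mem_nonZeroDivisors_of_ne_zero hx0) hxm
  -- third isomorphism theorem `A/(x) ≃ R/(𝔮 + (ϖ))`
  have hmapspan : (Ideal.span {ϖ}).map (Ideal.Quotient.mk 𝔮) = Ideal.span {x} := by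
    rw [Ideal.map_span, Set.image_singleton]
  let e : ((R ⧸ 𝔮) ⧸ Ideal.span {x}) ≃+* R ⧸ (𝔮 ⊔ Ideal.span {ϖ}) :=
    (Ideal.quotEquivOfEq hmapspan.symm).trans (DoubleQuot.quotQuotEquivQuotSup 𝔮 (Ideal.span {ϖ}))
  have hdimB : ringKrullDim (R ⧸ (𝔮 ⊔ Ideal.span {ϖ})) =
      ringKrullDim ((R ⧸ 𝔮) ⧸ Ideal.span {x}) :=
    (ringKrullDim_eq_of_ringEquiv e).symm
  refine ⟨by rw [hdimB, hdimA], ?_⟩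
  -- embedding dimension: `μ(𝔪·B) ≤ μ(𝔪_A) = dim A = dim B + 1`
  have hfac : Ideal.map (Ideal.Quotient.mk (𝔮 ⊔ Ideal.span {ϖ})) (maximalIdeal R) =
      (maximalIdeal (R ⧸ 𝔮)).map (Ideal.Quotient.factor (le_sup_left : 𝔮 ≤ 𝔮 ⊔ Ideal.span {ϖ})) := by
    rw [hmax, Ideal.map_map, Ideal.Quotient.factor_comp_mk]
  have hle : (Ideal.map (Ideal.Quotient.mk (𝔮 ⊔ Ideal.span {ϖ})) (maximalIdeal R)).spanFinrank ≤
      (maximalIdeal (R ⧸ 𝔮)).spanFinrank := by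
    rw [hfac]
    exact Ideal.spanFinrank_map_le_of_fg _ (maximalIdeal _).fg_of_isNoetherianRing
  have hregA : ((maximalIdeal (R ⧸ 𝔮)).spanFinrank : WithBot ℕ∞) = ringKrullDim (R ⧸ 𝔮) :=
    IsRegularLocalRing.spanFinrank_maximalIdeal
  calc ((Ideal.map (Ideal.Quotient.mk (𝔮 ⊔ Ideal.span {ϖ})) (maximalIdeal R)).spanFinrank : WithBot ℕ∞)
      ≤ (maximalIdeal (R ⧸ 𝔮)).spanFinrank := by exact_mod_cast hle
    _ = ringKrullDim (R ⧸ 𝔮) := hregA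
    _ = ringKrullDim (R ⧸ (𝔮 ⊔ Ideal.span {ϖ})) + 1 := by rw [hdimB, hdimA]

end Summit.ResolutionOfSingularities.ResolutionOfSingularities.Cruxes.EquisingularLift.StrataSplit
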